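import Literature.AnabelianGeometry.EtaleTheta.KummerEquivariance
import Literature.AnabelianGeometry.EtaleTheta.KummerMapExactness

/-!
# The natural `G`-ACTION on `lim_{→ H} H¹(H, Λ(A))` (action laws for `conjColimMap`; LANA §6.1 p.31)

Source: LANA Project interim report [LANA2026Report], §6.1, p. 31: "`κ : M → lim_{→ H} H¹(H, Λ(M))`.
This map is `G`-equivariant with respect to the natural action of `G` on `H¹`."  The landed file
`KummerEquivariance.lean` (abc-iut cell, L2 side) DEFINES, for a directed system `S` of NORMAL subgroups
of `G`, the map `conjColimMap S hS g : lim_{→} H¹(S i, Λ A) →+ lim_{→} H¹(S i, Λ A)` induced by the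
conjugation co-morphism `conj g = (γ ↦ g⁻¹ γ g, a ↦ g • a)`, and PROVES the equivariance
`conjColimMap g (κ a) = κ (g • a)` (`conjColimMap_kummerMap`).  THIS FILE proves that `g ↦ conjColimMap g`
IS AN ACTION — the two laws the word "action" carries — and packages it as a homomorphism into the
automorphism group of the colimit:

* `CoMorphism.conjAct_one`, `conjAct_mul` — at each normal level `H`: the `H¹`-map of `conj 1` is the
  identity (`groupCohomology.map_congr` against the identity co-morphism + `resH1_self`) and the `H¹`-map of
  `conj (h g)` is `conj h ∘ conj g` (`groupCohomology.map_comp`, via the landed `H1Map_comp`/`H1Map_congr`);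
* `CoMorphism.conjColimMap_toColimit`, `conjColimMap_one_apply`, `conjColimMap_mul_apply` — the same on the
  colimit (descent through `AddCommGroup.DirectLimit.induction_on`);
* `CoMorphism.conjColimEquiv S hS g : H1Colimit A S hS ≃+ H1Colimit A S hS` — the action of `g` as a
  group automorphism (inverse = action of `g⁻¹`), with `conjColimEquiv_kummerMap` (equivariance restated);
* `CoMorphism.conjColimMulAut S hS : G →* MulAut (Multiplicative (H1Colimit A S hS))` — the natural ACTION
  of `G` on the (multiplicatively written) colimit as a homomorphism into its automorphism group (in this
  Mathlib `AddAut` carries an additive group structure, so the `MonoidHom` lands in `MulAut` of the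
  multiplicative form), the shape in which [IUTchII] §3 consumes the ambient module
  "`lim_J H¹(Π_Ÿ(M^Θ_*)|_J, Π_μ(M^Θ_*))` with its natural conjugation action by `Π_X(M^Θ_*)`"
  (abc-iut-L6-t2 `TemperedThetaMonoids.ThetaEnvData.conj : Π →* MulAut H`), with
  `conjColimMulAut_ofAdd_kummerMap` (equivariance of `κ := ofAdd ∘ kummerMap`).

Used by `AbsoluteAnabelian/MonoidKummerEquivariantModel.lean` (GAP-LEDGER G-w4d019-1, equivariance half).
Classical ([cite: NeukirchSchmidtWingberg2008, I §5]); no statement of [EtTh]/[IUTch] asserted; nothing here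
bears on [IUTchIII] Cor. 3.12.  Groups and modules live in `Type` (Mathlib's `groupCohomology` is
single-universe), as in the landed files.
-/

noncomputable section

namespace Literature.AnabelianGeometry.EtaleTheta

open groupCohomology CategoryTheory

namespace CoMorphism

/-! ### Level `H`: `conj 1 = id`, `conj (h g) = conj h ∘ conj g` on `H¹(H, Λ A)` -/

section Level

variable {G : Type} [Group G] {A : Type} [CommGroup A] [MulDistribMulAction G A]
  (H : Subgroup G) [H.Normal]

/-- `conj 1` and the identity co-morphism have the same group homomorphism `γ ↦ 1⁻¹ γ 1 = γ`.
[cite: LANA2026Report, §6.1 p.31] -/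
theorem conj_one_groupHom : (conj G A 1).groupHom = (refl G A).groupHom :=
  MonoidHom.ext fun γ => by
    change (1 : G)⁻¹ * γ * (1 : G)⁻¹⁻¹ = γ
    simp

/-- `conj 1` and the identity co-morphism have the same module map `a ↦ 1 • a = a`.
[cite: LANA2026Report, §6.1 p.31] -/
theorem conj_one_map : (conj G A 1).map = (refl G A).map :=
  MonoidHom.ext fun a => one_smul G a

/-- The composite co-morphism `conj g ∘ conj h` has the group homomorphism of `conj (h g)`:
`g⁻¹ (h⁻¹ γ h) g = (h g)⁻¹ γ (h g)`. [cite: LANA2026Report, §6.1 p.31] -/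
theorem conj_comp_conj_groupHom (g h : G) :
    ((conj G A g).comp (conj G A h)).groupHom = (conj G A (h * g)).groupHom :=
  MonoidHom.ext fun γ => by
    change g⁻¹ * (h⁻¹ * γ * h⁻¹⁻¹) * g⁻¹⁻¹ = (h * g)⁻¹ * γ * (h * g)⁻¹⁻¹
    simp only [inv_inv, mul_inv_rev, mul_assoc]

/-- The composite co-morphism `conj g ∘ conj h` has the module map of `conj (h g)`:
`h • (g • a) = (h g) • a`. [cite: LANA2026Report, §6.1 p.31] -/
theorem conj_comp_conj_map (g h : G) :
    ((conj G A g).comp (conj G A h)).map = (conj G A (h * g)).map :=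
  MonoidHom.ext fun a => (mul_smul h g a).symm

/-- **`conj 1` acts as the identity on `H¹(H, Λ A)`** (`H` normal). [cite: LANA2026Report, §6.1 p.31] -/
theorem conjAct_one (x : H1 (cyclotomeRep (A := A) H)) : conjAct H (1 : G) x = x := by
  have e : (conj G A 1).H1Map (conj_cond 1 H) = (refl G A).H1Map (refl_cond (le_refl H)) :=
    H1Map_congr _ _ (conj_one_groupHom (G := G) (A := A)) (conj_one_map (G := G) (A := A)) _ _
  change (conj G A 1).H1Map (conj_cond 1 H) x = x
  rw [e]
  exact resH1_self H x

/-- **`conj (h g) = conj h ∘ conj g` on `H¹(H, Λ A)`** (`H` normal): the natural action is a LEFT action.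
[cite: LANA2026Report, §6.1 p.31] -/
theorem conjAct_mul (g h : G) (x : H1 (cyclotomeRep (A := A) H)) :
    conjAct H (h * g) x = conjAct H h (conjAct H g x) := by
  have h₃ : H.map ((conj G A g).comp (conj G A h)).groupHom ≤ H := by
    rw [conj_comp_conj_groupHom]
    exact conj_cond (h * g) H
  have e₁ : (conj G A g).H1Map (conj_cond g H) ≫ (conj G A h).H1Map (conj_cond h H) =
      ((conj G A g).comp (conj G A h)).H1Map h₃ :=
    H1Map_comp _ _ _ _ _
  have e₂ : ((conj G A g).comp (conj G A h)).H1Map h₃ = (conj G A (h * g)).H1Map (conj_cond (h * g) H) :=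
    H1Map_congr _ _ (conj_comp_conj_groupHom g h) (conj_comp_conj_map g h) _ _
  change (conj G A (h * g)).H1Map (conj_cond (h * g) H) x =
    (conj G A h).H1Map (conj_cond h H) ((conj G A g).H1Map (conj_cond g H) x)
  rw [← e₂, ← e₁]
  rfl

end Level

/-! ### The colimit: the action of `G` on `lim_{→ i} H¹(S i, Λ A)` -/

section Colim

variable {G : Type} [Group G] {A : Type} [CommGroup A] [MulDistribMulAction G A]
  {ι : Type} [Preorder ι] [DecidableEq ι] [IsDirectedOrder ι] [Nonempty ι] (S : ι → Subgroup G)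
  (hS : ∀ ⦃i j : ι⦄, i ≤ j → S j ≤ S i) [hN : ∀ i, (S i).Normal]

omit [Nonempty ι] in
/-- `conjColimMap g` on the image of a level-`i` class is the level-`i` action `conjAct`.
[cite: LANA2026Report, §6.1 p.31] -/
theorem conjColimMap_toColimit (g : G) (i : ι) (x : H1 (cyclotomeRep (A := A) (S i))) :
    conjColimMap S hS g (toColimit S hS i x) = toColimit S hS i (conjAct (S i) g x) :=
  colimMap_toColimit _ S hS S hS id (conj_cond_system S g) i x

/-- **`1 ∈ G` acts as the identity** on `lim_{→} H¹(S i, Λ A)`. [cite: LANA2026Report, §6.1 p.31] -/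
theorem conjColimMap_one_apply (z : H1Colimit A S hS) : conjColimMap S hS (1 : G) z = z := by
  induction z using AddCommGroup.DirectLimit.induction_on with
  | ih i x => rw [conjColimMap_toColimit, conjAct_one]

/-- **`(h g)` acts as `h` after `g`** on `lim_{→} H¹(S i, Λ A)`. [cite: LANA2026Report, §6.1 p.31] -/
theorem conjColimMap_mul_apply (g h : G) (z : H1Colimit A S hS) :
    conjColimMap S hS (h * g) z = conjColimMap S hS h (conjColimMap S hS g z) := by
  induction z using AddCommGroup.DirectLimit.induction_on with
  | ih i x => rw [conjColimMap_toColimit, conjColimMap_toColimit, conjColimMap_toColimit, conjAct_mul]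

/-- The action of `g ∈ G` on `lim_{→} H¹(S i, Λ A)` as a group AUTOMORPHISM (inverse: the action of `g⁻¹`).
[cite: LANA2026Report, §6.1 p.31] -/
def conjColimEquiv (g : G) : H1Colimit A S hS ≃+ H1Colimit A S hS :=
  { conjColimMap S hS g with
    invFun := conjColimMap S hS g⁻¹
    left_inv := fun z => by
      change conjColimMap S hS g⁻¹ (conjColimMap S hS g z) = z
      rw [← conjColimMap_mul_apply, inv_mul_cancel, conjColimMap_one_apply]
    right_inv := fun z => by
      change conjColimMap S hS g (conjColimMap S hS g⁻¹ z) = z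
      rw [← conjColimMap_mul_apply, mul_inv_cancel, conjColimMap_one_apply] }

/-- `conjColimEquiv g` is `conjColimMap g` on elements. [cite: LANA2026Report, §6.1 p.31] -/
@[simp] theorem conjColimEquiv_apply (g : G) (z : H1Colimit A S hS) :
    conjColimEquiv S hS g z = conjColimMap S hS g z := rfl

/-- **Equivariance of the Kummer map for the automorphisms `conjColimEquiv`**: `g ⋆ κ(a) = κ(g • a)` (the
landed `conjColimMap_kummerMap`, restated). [cite: LANA2026Report, §6.1 p.31] -/
theorem conjColimEquiv_kummerMap [RootableBy A ℕ] (hc : IsExhausted A S) (g : G) (a : A) :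
    conjColimEquiv S hS g (kummerMap hS hc a) = kummerMap hS hc (g • a) :=
  conjColimMap_kummerMap S hS hc g a

/-- **The natural ACTION of `G` on `lim_{→ i} H¹(S i, Λ A)`** ("the natural action of `G` on `H¹`",
[cite: LANA2026Report, §6.1 p.31]) as a homomorphism `G →* MulAut _` on the MULTIPLICATIVELY written
colimit `Multiplicative (lim_{→} H¹(S i, Λ A))` — the shape of "equipped with a natural conjugation
action", [IUTchII] Prop. 3.1 (ii) (in this Mathlib `AddAut` carries an ADDITIVE group structure, so the
multiplicative form is the one that is a `MonoidHom` target). -/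
def conjColimMulAut : G →* MulAut (Multiplicative (H1Colimit A S hS)) where
  toFun g := AddEquiv.toMultiplicative (conjColimEquiv S hS g)
  map_one' := MulEquiv.ext fun z => congrArg Multiplicative.ofAdd (conjColimMap_one_apply S hS z.toAdd)
  map_mul' h g := MulEquiv.ext fun z =>
    congrArg Multiplicative.ofAdd (conjColimMap_mul_apply S hS g h z.toAdd)

/-- `conjColimMulAut g` on elements. [cite: LANA2026Report, §6.1 p.31] -/
@[simp] theorem conjColimMulAut_apply (g : G) (z : Multiplicative (H1Colimit A S hS)) :
    conjColimMulAut S hS g z = Multiplicative.ofAdd (conjColimMap S hS g z.toAdd) := rfl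

/-- Equivariance of the Kummer map in multiplicative notation: for `κ a := ofAdd (kummerMap a)`,
`g ⋆ κ(a) = κ(g • a)`. [cite: LANA2026Report, §6.1 p.31] -/
theorem conjColimMulAut_ofAdd_kummerMap [RootableBy A ℕ] (hc : IsExhausted A S) (g : G) (a : A) :
    conjColimMulAut S hS g (Multiplicative.ofAdd (kummerMap hS hc a)) =
      Multiplicative.ofAdd (kummerMap hS hc (g • a)) := by
  rw [conjColimMulAut_apply, toAdd_ofAdd, conjColimMap_kummerMap]

end Colim

end CoMorphism

end Literature.AnabelianGeometry.EtaleTheta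

end
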